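import Summits.Ventures.CertifiedManyBodySolver.Downfold.EmeryBoxesCupratesLowerFace
import HarnessLib

/-!
# The 3BE twin of S2's anchor box: `emeryBoxLa214M15` — La₂₋ₓSrₓCuO₄ at x = 1/8 (column M15), the typed
# three-band box of record, with its 64-vertex and LOWER-FACE (4-corner) doors

Venture CertifiedManyBodySolver, cell `pub/hubbard-downfold` (stage S1 = ROUTER), seat hubbard-downfold-mod-4;
namespace `Summit.Ventures.CertifiedManyBodySolver.Downfold`. Sequel of `EmeryBoxesCuprates` (`emeryBoxLa214`, x = 0)
and `EmeryBoxesCupratesLowerFace`. The La-214 «THREE-BAND (3BE) COMPANION BOX» (router/BOXES/La2CuO4-family.md l.181)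
is shared by every LSCO column except for the hole count `n_holes = 1 + x` with the box's `n`-row width: column M15
(x = 0.125; `n ∈ [0.855, 0.895]` e/site, l.156) ⇒ `n_holes ∈ [1.105, 1.145]` ⇒ cell filling `ρ = (6 − n_holes)/4 ∈
[1.21375, 1.22375]`. S2's anchor box #1 (`U/t 8 ± 0.5, t′/t −0.25 ± 0.05, n 0.875 ± 0.01`, cell `pub/hubbard-fast`) is an
LSCO-1/8 box in the one-band object-E reading (La2CuO4-family.md l.182); this file is its THREE-band counterpart.

* `emeryBoxLa214M15` — entries of `emeryBoxLa214` with `n_holes ∈ [1.105, 1.145]`; `_mem_iff`; `_cellFilling`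
  (`ρ ∈ [971/800, 979/800]`); the delivered six-box is that of `emeryBoxLa214` (same five seam entries), so
  `emeryBoxLa214M15_energyFloor` (64 vertices) and `emeryBoxLa214M15_energyFloor_lowerFace` (the 4 corners
  `(t_pd, t_pp) ∈ {1.29, 1.52} × {0.46, 0.66}` at `(ε_d, ε_p, U_d, U_p) = (1.7, 0, 7, 3.4)`) read exactly as for x = 0 —
  only the filling `ρ` at which S2 certifies differs; `_witness_mem`.

Everything here is PROVED; SCREENING-GRADE box typed verbatim; nothing about the material is certified by typing.
-/

namespace Summit.Ventures.CertifiedManyBodySolver.Downfold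

open Literature.MathematicalPhysics.QuantumLattice

/-- `nHoles ∈ [1.105, 1.145]`: n_holes = 1 + x at x = 1/8 with the box's `n`-row width ±0.02 (La2CuO4-family.md l.156,
column M15). [folklore] -/
def la214M15Emery_nH : Entry := Entry.ofEnds (221/200) (229/200) (by norm_num) .screening

/-- **The typed 3BE box of record `emeryBoxLa214M15`** (La₂₋ₓSrₓCuO₄, x = 0.125, P = 0): the La-214 companion entries
with the M15 hole count. [folklore] -/
def emeryBoxLa214M15 : EmeryBox := fun c =>
  match c with
  | .DeltaPd => some la214Emery_Delta
  | .tpd => some la214Emery_tpd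
  | .tpp => some la214Emery_tpp
  | .tppP => some la214Emery_tppP
  | .Udd => some la214Emery_Udd
  | .Upp => some la214Emery_Upp
  | .Vpd => some la214Emery_Vpd
  | .nHoles => some la214M15Emery_nH

/-- **Membership in `emeryBoxLa214M15` unfolded.** [folklore] -/
theorem emeryBoxLa214M15_mem_iff (p : EmeryCoord → ℝ) :
    emeryBoxLa214M15.Mem p ↔
      (((17/10) : ℚ) : ℝ) ≤ p .DeltaPd ∧ p .DeltaPd ≤ (((4) : ℚ) : ℝ) ∧
      (((129/100) : ℚ) : ℝ) ≤ p .tpd ∧ p .tpd ≤ (((38/25) : ℚ) : ℝ) ∧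
      (((23/50) : ℚ) : ℝ) ≤ p .tpp ∧ p .tpp ≤ (((33/50) : ℚ) : ℝ) ∧
      (((3/25) : ℚ) : ℝ) ≤ p .tppP ∧ p .tppP ≤ (((3/20) : ℚ) : ℝ) ∧
      (((7) : ℚ) : ℝ) ≤ p .Udd ∧ p .Udd ≤ (((21/2) : ℚ) : ℝ) ∧
      (((17/5) : ℚ) : ℝ) ≤ p .Upp ∧ p .Upp ≤ (((116/25) : ℚ) : ℝ) ∧
      (((57/100) : ℚ) : ℝ) ≤ p .Vpd ∧ p .Vpd ≤ (((47/25) : ℚ) : ℝ) ∧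
      (((221/200) : ℚ) : ℝ) ≤ p .nHoles ∧ p .nHoles ≤ (((229/200) : ℚ) : ℝ) := by
  constructor
  · intro h
    have h0 := (Entry.mem_ofEnds_iff _ _ _ _ _).1 (h .DeltaPd la214Emery_Delta rfl)
    have h1 := (Entry.mem_ofEnds_iff _ _ _ _ _).1 (h .tpd la214Emery_tpd rfl)
    have h2 := (Entry.mem_ofEnds_iff _ _ _ _ _).1 (h .tpp la214Emery_tpp rfl)
    have h3 := (Entry.mem_ofEnds_iff _ _ _ _ _).1 (h .tppP la214Emery_tppP rfl)
    have h4 := (Entry.mem_ofEnds_iff _ _ _ _ _).1 (h .Udd la214Emery_Udd rfl)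
    have h5 := (Entry.mem_ofEnds_iff _ _ _ _ _).1 (h .Upp la214Emery_Upp rfl)
    have h6 := (Entry.mem_ofEnds_iff _ _ _ _ _).1 (h .Vpd la214Emery_Vpd rfl)
    have h7 := (Entry.mem_ofEnds_iff _ _ _ _ _).1 (h .nHoles la214M15Emery_nH rfl)
    exact ⟨h0.1, h0.2, h1.1, h1.2, h2.1, h2.2, h3.1, h3.2, h4.1, h4.2, h5.1, h5.2, h6.1, h6.2, h7.1, h7.2⟩
  · rintro ⟨a0, b0, a1, b1, a2, b2, a3, b3, a4, b4, a5, b5, a6, b6, a7, b7⟩ i e hi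
    cases i <;> simp only [emeryBoxLa214M15, Option.some.injEq] at hi <;> subst hi
    · exact (Entry.mem_ofEnds_iff _ _ _ _ _).2 ⟨a0, b0⟩
    · exact (Entry.mem_ofEnds_iff _ _ _ _ _).2 ⟨a1, b1⟩
    · exact (Entry.mem_ofEnds_iff _ _ _ _ _).2 ⟨a2, b2⟩
    · exact (Entry.mem_ofEnds_iff _ _ _ _ _).2 ⟨a3, b3⟩
    · exact (Entry.mem_ofEnds_iff _ _ _ _ _).2 ⟨a4, b4⟩
    · exact (Entry.mem_ofEnds_iff _ _ _ _ _).2 ⟨a5, b5⟩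
    · exact (Entry.mem_ofEnds_iff _ _ _ _ _).2 ⟨a6, b6⟩
    · exact (Entry.mem_ofEnds_iff _ _ _ _ _).2 ⟨a7, b7⟩

/-- **Cell filling of `emeryBoxLa214M15`**: `ρ = (6 − n_holes)/4 ∈ [971/800, 979/800] = [1.21375, 1.22375]`. [folklore] -/
theorem emeryBoxLa214M15_cellFilling {p : EmeryCoord → ℝ} (hp : emeryBoxLa214M15.Mem p) :
    emeryCellFilling p ∈ Set.Icc ((((6 : ℚ) - 229/200) / 4 : ℚ) : ℝ) ((((6 : ℚ) - 221/200) / 4 : ℚ) : ℝ) := by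
  have h := emeryCellFilling_mem_Icc (E := emeryBoxLa214M15) (eN := la214M15Emery_nH) rfl hp
  simpa [la214M15Emery_nH] using h

/-- **S2 box statement ⇒ box word on `emeryBoxLa214M15`** (same delivered six-box as `emeryBoxLa214`). [folklore] -/
theorem emeryBoxLa214M15_energyWord {W : (Fin 6 → ℝ) → Prop}
    (hW : ∀ q ∈ Set.Icc (![129/100, 23/50, 17/10, 0, 7, 17/5] : Fin 6 → ℝ) ![38/25, 33/50, 4, 0, 21/2, 116/25], W q) :
    HoldsOn (fun p : EmeryCoord → ℝ => W (emeryLineCoords 0 p)) emeryBoxLa214M15 := by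
  have h := holdsOn_of_forall_emeryLineBox (E := emeryBoxLa214M15) (εp := 0) (eA := la214Emery_tpd) (eB := la214Emery_tpp)
    (eD := la214Emery_Delta) (eUd := la214Emery_Udd) (eUp := la214Emery_Upp) rfl rfl rfl rfl rfl (W := W)
    (by rw [la214_emeryLo, la214_emeryHi]; exact hW)
  simpa using h

/-- **Vertex-certified floor on `emeryBoxLa214M15`** (64 vertices of the La-214 six-box; the filling `ρ` at which S2
certifies is the consumer's — `emeryBoxLa214M15_cellFilling` brackets it). [cite: Israel1979, Thm. I.3.4] -/
theorem emeryBoxLa214M15_energyFloor (s : Fin 4 → ℝ) (ρ : ℝ) {m : ℝ}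
    (hm : ∀ v ∈ Fintype.piFinset (fun i => ({(![129/100, 23/50, 17/10, 0, 7, 17/5] : Fin 6 → ℝ) i,
        (![38/25, 33/50, 4, 0, 21/2, 116/25] : Fin 6 → ℝ) i} : Finset ℝ)),
      m ≤ emeryEnergyDensity (emeryLine s v) ρ) :
    HoldsOn (fun p : EmeryCoord → ℝ => m ≤ emeryEnergyDensity (emeryLine s (emeryLineCoords 0 p)) ρ) emeryBoxLa214M15 := by
  have h := holdsOn_emeryEnergyFloor (E := emeryBoxLa214M15) (εp := 0) (eA := la214Emery_tpd) (eB := la214Emery_tpp)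
    (eD := la214Emery_Delta) (eUd := la214Emery_Udd) (eUp := la214Emery_Upp) rfl rfl rfl rfl rfl s ρ (m := m)
    (by rw [la214_emeryLo, la214_emeryHi]; exact hm)
  simpa using h

/-- **Four corner certificates bind `emeryBoxLa214M15`** (lower-face rule): vertices of
`Set.Icc (129/100, 23/50, 17/10, 0, 7, 17/5) (38/25, 33/50, 17/10, 0, 7, 17/5)`. [cite: Israel1979, Thm. I.3.4] -/
theorem emeryBoxLa214M15_energyFloor_lowerFace (s : Fin 4 → ℝ) (ρ : ℝ) {m : ℝ}
    (hm : ∀ v ∈ Fintype.piFinset (fun i => ({(![129/100, 23/50, 17/10, 0, 7, 17/5] : Fin 6 → ℝ) i,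
        (![38/25, 33/50, 17/10, 0, 7, 17/5] : Fin 6 → ℝ) i} : Finset ℝ)),
      m ≤ emeryEnergyDensity (emeryLine s v) ρ) :
    HoldsOn (fun p : EmeryCoord → ℝ => m ≤ emeryEnergyDensity (emeryLine s (emeryLineCoords 0 p)) ρ) emeryBoxLa214M15 := by
  have h := holdsOn_emeryEnergyFloor_lowerFace (E := emeryBoxLa214M15) (εp := 0) (eA := la214Emery_tpd)
    (eB := la214Emery_tpp) (eD := la214Emery_Delta) (eUd := la214Emery_Udd) (eUp := la214Emery_Upp)
    rfl rfl rfl rfl rfl s ρ (m := m) (by rw [la214_emeryLo, la214_emeryHi, la214_lowerFace]; exact hm)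
  simpa using h

/-- **`emeryBoxLa214M15` refines nothing away from `emeryBoxLa214` except the hole count**: every word on the x = 0
box that does not read `n_holes` transfers — stated as: a parameter vector of the M15 box with its hole count reset
to `1` lies in `emeryBoxLa214`. [folklore] -/
theorem emeryBoxLa214_mem_of_M15 {p : EmeryCoord → ℝ} (hp : emeryBoxLa214M15.Mem p) :
    emeryBoxLa214.Mem (Function.update p .nHoles 1) := by
  rw [emeryBoxLa214M15_mem_iff] at hp
  rw [emeryBoxLa214_mem_iff]
  obtain ⟨a0, b0, a1, b1, a2, b2, a3, b3, a4, b4, a5, b5, a6, b6, -, -⟩ := hp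
  simp only [Function.update_self, Function.update_of_ne, ne_eq, reduceCtorEq, not_false_eq_true]
  refine ⟨a0, b0, a1, b1, a2, b2, a3, b3, a4, b4, a5, b5, a6, b6, ?_, ?_⟩ <;> norm_num

/-- **Non-vacuity witness** at x = 1/8: the `emeryBoxLa214` witness vector with `n_holes = 9/8`. [folklore] -/
theorem emeryBoxLa214M15_witness_mem :
    emeryBoxLa214M15.Mem (fun c => match c with
      | .DeltaPd => (((2911/1000) : ℚ) : ℝ)
      | .tpd => (((1391/1000) : ℚ) : ℝ)
      | .tpp => (((33/50) : ℚ) : ℝ)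
      | .tppP => (((17/125) : ℚ) : ℝ)
      | .Udd => (((7) : ℚ) : ℝ)
      | .Upp => (((116/25) : ℚ) : ℝ)
      | .Vpd => (((47/25) : ℚ) : ℝ)
      | .nHoles => (((9/8) : ℚ) : ℝ)
      ) := by
  rw [emeryBoxLa214M15_mem_iff]
  refine ⟨?_, ?_, ?_, ?_, ?_, ?_, ?_, ?_, ?_, ?_, ?_, ?_, ?_, ?_, ?_, ?_⟩ <;> exact_mod_cast (by norm_num)

end Summit.Ventures.CertifiedManyBodySolver.Downfold
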